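import Summits.ValiantsHypothesis.ValiantsHypothesis.Theorems.MonotoneRestorationOrbitRestorationQPValueOrbitProducts
import Summits.ValiantsHypothesis.ValiantsHypothesis.Theorems.MonotoneRestorationOrbitRestorationQPValueOrbitClosure
import HarnessLib

/-!
# Sums of products with quasi-polynomial-orbit factor multisets are orbit-restorable (ORBIT currency, IX)

Route MonotoneRestoration, crux `OrbitRestorationQP` (stmt-ValiantsHypothesis-18293), namespace
`Summit.ValiantsHypothesis.ValiantsHypothesis.Theorems.ValueProducts`.

Toward the first rung of the class ladder (`SigmaPiSigmaRestorationQP`, line `depth-three-rung`): a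
GENERALISATION of stub B (`stub_circuitOfEquivariantTerms`, g0, p548827).  Stub B restores symmetry for an
`S_n`-STABLE multiset `T` of quasi-polynomially many products of affine forms.  Here no global stability is
needed and the factors need not be affine:

* `exists_symmetric_of_productTerms` — if the factors `φ s i` are values of a value derivation with value
  orbits `≤ B` and every factor MULTISET `{φ s i}_i` has `Γ`-orbit `≤ B`, then any `Γ`-invariant
  `f = Σ_s a_s Π_i φ s i` (ANY number of terms `s`) has a `Γ`-symmetric circuit with `ORB ≤ B²`
  (products through Newton's identities, `…ValueOrbitProducts.lean`; the final sum is one step of orbit 1);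
* `affineBase` — the value derivation of a family of affine forms (variables, `1`, the forms);
* `qpOrbitRestorable_of_affineProductTerms` — **ΣΠΣ expressions whose product gates have factor multisets of
  quasi-polynomial `Sym(Fin n)`-orbit compute `QPOrbitRestorable` polynomials** (line vocabulary, cost
  `c ↦ c + 5`), whatever the number of terms.  In particular an `S_n`-stable family of terms of
  quasi-polynomial size qualifies (each member multiset has orbit `≤ |T|`), which is stub B.

Everything is proved. [folklore]

## References
* A. Dawar, G. Wilsenach, *Symmetric arithmetic circuits*, ToC 21 (2025), §3.3. [DawarWilsenach2025]
-/

noncomputable section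

open scoped Classical

-- `Summit.ValiantsHypothesis.ValiantsHypothesis.…` is the tree's single-conjunct layout (Sub = Summit).
set_option linter.dupNamespace false

namespace Summit.ValiantsHypothesis.ValiantsHypothesis.Theorems

universe u v

namespace ValueProducts

open Finset Literature.Computability.AlgebraicComplexity

variable {K : Type u} {X : Type v} [Field K]
variable {τ ι : Type} [Fintype τ] [Fintype ι]

/-! ### Sums of products of values -/

/-- **Invariant sums of products with small-orbit factor multisets have small-orbit symmetric circuits.**
[folklore] -/
theorem exists_symmetric_of_productTerms [Fintype X] [CharZero K] {Γ : Type} [Group Γ] [Fintype Γ]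
    [MulAction Γ X] (𝒟 : ValueDerivation K X) (φ : τ → ι → MvPolynomial X K) (hφ : ∀ s i, φ s i ∈ 𝒟.S)
    (a : τ → K) {B : ℕ} (hB : 1 ≤ B) (hX : ∀ x : X, (Set.range fun γ : Γ => γ • x).ncard ≤ B)
    (hS : ∀ q ∈ 𝒟.S, (Set.range fun γ : Γ => ren γ q).ncard ≤ B)
    (hM : ∀ s, (Set.range fun γ : Γ => ((univ : Finset ι).val.map (φ s)).map (ren γ)).ncard ≤ B)
    {f : MvPolynomial X K} (hf : f = ∑ s, MvPolynomial.C (a s) * ∏ i, φ s i) (hfix : ∀ γ : Γ, ren γ f = f) :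
    ∃ (G : Type (max u v)) (_ : Fintype G) (C : LabelledArithCircuit K X Unit G),
      C.IsSymmetric Γ ∧ C.eval (C.output ()) = f ∧ C.orbitSize Γ ≤ B * B := by
  let d : StepData K X := StepData.sum ((univ : Finset τ).val.map fun s => (a s, ∏ i, φ s i))
  have hd : ∀ u ∈ d.args, u ∈ (prodAdjoin φ 𝒟 hφ).S := by
    intro u hu
    simp only [d, StepData.args, Multiset.map_map, Function.comp_def, Multiset.mem_map, Finset.mem_val,
      Finset.mem_univ, true_and] at hu
    obtain ⟨s, rfl⟩ := hu
    exact prod_mem_prodAdjoin_S φ 𝒟 hφ s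
  have hval : d.value = f := by
    rw [hf, StepData.value, Multiset.map_map, ← Finset.sum_eq_multiset_sum]
    rfl
  refine ((prodAdjoin φ 𝒟 hφ).adjoin d hd).exists_symmetric_of_valueDerivation
    (ValueDerivation.mem_adjoin_S.2 (Or.inl hval.symm)) hB hfix hX fun q hq => ?_
  rcases ValueDerivation.mem_adjoin_S.1 hq with rfl | hq
  · rw [hval]
    rw [show (Set.range fun γ : Γ => ren γ f) = {f} from ?_]
    · rw [Set.ncard_singleton]; exact hB
    · ext q; simp only [Set.mem_range, hfix, Set.mem_singleton_iff, exists_const, eq_comm]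
  · exact orbit_prodAdjoin_le φ 𝒟 hφ hS hM hq

/-! ### Affine forms -/

variable (w₀ : τ → ι → K) (w : τ → ι → X → K)

/-- The affine form with constant `w₀ s i` and coefficients `w s i`. [folklore] -/
def affineForm [Fintype X] (s : τ) (i : ι) : MvPolynomial X K :=
  MvPolynomial.C (w₀ s i) + ∑ x, MvPolynomial.C (w s i x) * MvPolynomial.X x

/-- **The value derivation of a family of affine forms**: the variables and `1` (rank `0`), the forms
(rank `1`). [folklore] -/
def affineBase [Fintype X] : ValueDerivation K X where
  S := insert (MvPolynomial.C 1) ((univ : Finset X).image MvPolynomial.X) ∪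
    (univ ×ˢ univ).image (fun p : τ × ι => affineForm w₀ w p.1 p.2)
  rank := fun q => if q ∈ insert (MvPolynomial.C 1) ((univ : Finset X).image MvPolynomial.X) then 0 else 1
  step := by
    intro q hq
    by_cases h0 : q ∈ insert (MvPolynomial.C 1) ((univ : Finset X).image MvPolynomial.X)
    · rcases Finset.mem_insert.1 h0 with rfl | hx
      · exact ⟨StepData.const 1, ⟨rfl, fun u hu => by simp [StepData.args] at hu⟩⟩
      · obtain ⟨x, -, rfl⟩ := Finset.mem_image.1 hx
        exact ⟨StepData.var x, ⟨rfl, fun u hu => by simp [StepData.args] at hu⟩⟩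
    · have hq' : q ∈ (univ ×ˢ univ).image (fun p : τ × ι => affineForm w₀ w p.1 p.2) :=
        (Finset.mem_union.1 hq).resolve_left h0
      obtain ⟨p, -, rfl⟩ := Finset.mem_image.1 hq'
      refine ⟨StepData.sum ((w₀ p.1 p.2, MvPolynomial.C 1) ::ₘ
        ((univ : Finset X).val.map fun x => (w p.1 p.2 x, MvPolynomial.X x))), ⟨?_, fun u hu => ?_⟩⟩
      · simp only [StepData.value, Multiset.map_cons, Multiset.sum_cons, Multiset.map_map, Function.comp_def,
          map_one, mul_one, affineForm, Finset.sum_eq_multiset_sum]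
      · simp only [StepData.args, Multiset.map_cons, Multiset.map_map, Function.comp_def, Multiset.mem_cons,
          Multiset.mem_map, Finset.mem_val, Finset.mem_univ, true_and] at hu
        have hu0 : u ∈ insert (MvPolynomial.C 1) ((univ : Finset X).image MvPolynomial.X) := by
          rcases hu with rfl | ⟨x, rfl⟩
          · exact Finset.mem_insert_self _ _
          · exact Finset.mem_insert_of_mem (Finset.mem_image.2 ⟨x, Finset.mem_univ x, rfl⟩)
        refine ⟨Finset.mem_union_left _ hu0, ?_⟩
        simp only [if_pos hu0, if_neg h0]
        exact Nat.zero_lt_one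

/-- The forms are values of `affineBase`. [folklore] -/
theorem affineForm_mem_affineBase [Fintype X] (s : τ) (i : ι) :
    affineForm w₀ w s i ∈ (affineBase w₀ w).S :=
  Finset.mem_union_right _ (Finset.mem_image.2 ⟨(s, i), by simp, rfl⟩)

/-- Membership in `affineBase`. [folklore] -/
theorem mem_affineBase_S [Fintype X] {q : MvPolynomial X K} (hq : q ∈ (affineBase w₀ w).S) :
    q = MvPolynomial.C 1 ∨ (∃ x, q = MvPolynomial.X x) ∨ ∃ s i, q = affineForm w₀ w s i := by
  rcases Finset.mem_union.1 hq with h | h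
  · rcases Finset.mem_insert.1 h with h | h
    · exact Or.inl h
    · obtain ⟨x, -, rfl⟩ := Finset.mem_image.1 h
      exact Or.inr (Or.inl ⟨x, rfl⟩)
  · obtain ⟨p, -, rfl⟩ := Finset.mem_image.1 h
    exact Or.inr (Or.inr ⟨p.1, p.2, rfl⟩)

/-! ### The ΣΠΣ corollary in the square-symmetric setting -/

/-- Arithmetic: `2^((L+c)^c) ≤ 2^((L+c+2)^(c+2))` and `n² ≤ 2^((L+c+2)^(c+2))`. [folklore] -/
theorem bound_arith (n c : ℕ) :
    2 ^ ((Nat.log 2 n + c) ^ c) ≤ 2 ^ ((Nat.log 2 n + (c + 2)) ^ (c + 2)) ∧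
      n * n ≤ 2 ^ ((Nat.log 2 n + (c + 2)) ^ (c + 2)) := by
  set L := Nat.log 2 n with hL
  have h1 : (L + c) ^ c ≤ (L + (c + 2)) ^ (c + 2) :=
    (Nat.pow_le_pow_left (by omega) c).trans (Nat.pow_le_pow_right (by omega) (by omega))
  have h2 : 2 * L + 2 ≤ (L + (c + 2)) ^ (c + 2) := by
    have h3 : 2 * L + 2 ≤ (L + (c + 2)) ^ 2 := by rw [sq]; nlinarith
    exact h3.trans (Nat.pow_le_pow_right (by omega) (by omega))
  exact ⟨Nat.pow_le_pow_right (by norm_num) h1,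
    (ValueOrbit.sq_le_pow_log n).trans (Nat.pow_le_pow_right (by norm_num) h2)⟩

open OrbitRestorationQPDepthThreeRung in
/-- **ΣΠΣ EXPRESSIONS WITH QUASI-POLYNOMIAL-ORBIT PRODUCT GATES ARE ORBIT-RESTORABLE.**  Let
`f = Σ_s a_s Π_i ℓ_{s,i}` be a diagonally `Sym(Fin n)`-invariant polynomial over `ℂ` written as a sum (of ANY
length) of scaled products of affine forms such that every form `ℓ_{s,i}` and every factor multiset
`{ℓ_{s,i}}_i` has `Sym(Fin n)`-orbit of size `≤ 2^((log₂ n + c)^c)`.  Then `QPOrbitRestorable (c + 5) n f`.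
This generalises stub B of line `depth-three-rung` (there the whole family of terms is `S_n`-stable of
quasi-polynomial size, so every member multiset and form has quasi-polynomial orbit); no global stability
and no bound on the number of terms is needed. [folklore] -/
theorem qpOrbitRestorable_of_affineProductTerms {n c : ℕ} (w₀ : τ → ι → ℂ)
    (w : τ → ι → (Fin n × Fin n) → ℂ) (a : τ → ℂ)
    (hform : ∀ s i, (Set.range fun σ : Equiv.Perm (Fin n) => ren σ (affineForm w₀ w s i)).ncard ≤
      2 ^ ((Nat.log 2 n + c) ^ c))
    (hmult : ∀ s, (Set.range fun σ : Equiv.Perm (Fin n) =>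
      ((univ : Finset ι).val.map (affineForm w₀ w s)).map (ren σ)).ncard ≤ 2 ^ ((Nat.log 2 n + c) ^ c))
    {f : MvPolynomial (Fin n × Fin n) ℂ} (hf : f = ∑ s, MvPolynomial.C (a s) * ∏ i, affineForm w₀ w s i)
    (hfix : ∀ σ : Equiv.Perm (Fin n), ren σ f = f) : QPOrbitRestorable (c + 5) n f := by
  obtain ⟨hB1, hB2⟩ := bound_arith n c
  set B := 2 ^ ((Nat.log 2 n + (c + 2)) ^ (c + 2)) with hB
  have hS : ∀ q ∈ (affineBase w₀ w).S, (Set.range fun σ : Equiv.Perm (Fin n) => ren σ q).ncard ≤ B := by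
    intro q hq
    rcases mem_affineBase_S w₀ w hq with rfl | ⟨x, rfl⟩ | ⟨s, i, rfl⟩
    · refine le_trans (ValueOrbit.ncard_orbit_of_invariant fun σ => ren_C σ 1) (Nat.one_le_two_pow)
    · refine le_trans ?_ ((ValueOrbit.ncard_orbit_var_le n x).trans hB2)
      exact TermCircuit.ncard_range_le_of_factor _ (fun σ : Equiv.Perm (Fin n) => σ • x) MvPolynomial.X
        fun σ => ren_X σ x
    · exact (hform s i).trans hB1
  let d : StepData ℂ (Fin n × Fin n) :=
    StepData.sum ((univ : Finset τ).val.map fun s => (a s, ∏ i, affineForm w₀ w s i))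
  have hd : ∀ u ∈ d.args, u ∈ (prodAdjoin (affineForm w₀ w) (affineBase w₀ w)
      (affineForm_mem_affineBase w₀ w)).S := by
    intro u hu
    simp only [d, StepData.args, Multiset.map_map, Function.comp_def, Multiset.mem_map, Finset.mem_val,
      Finset.mem_univ, true_and] at hu
    obtain ⟨s, rfl⟩ := hu
    exact prod_mem_prodAdjoin_S _ _ _ s
  have hval : d.value = f := by
    rw [hf, StepData.value, Multiset.map_map, ← Finset.sum_eq_multiset_sum]
    rfl
  have key := ValueOrbit.qpOrbit_of_valueDerivation (c := c + 2)
    ((prodAdjoin (affineForm w₀ w) (affineBase w₀ w) (affineForm_mem_affineBase w₀ w)).adjoin d hd)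
    (ValueDerivation.mem_adjoin_S.2 (Or.inl hval.symm)) hfix (fun q hq => by
      rcases ValueDerivation.mem_adjoin_S.1 hq with rfl | hq
      · rw [hval]; exact (ValueOrbit.ncard_orbit_of_invariant hfix).trans Nat.one_le_two_pow
      · exact orbit_prodAdjoin_le _ _ _ hS (fun s => (hmult s).trans hB1) hq)
  exact key

end ValueProducts

end Summit.ValiantsHypothesis.ValiantsHypothesis.Theorems

end
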